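import Mathlib
import Summits.AtomisticToContinuum.HydrodynamicLimit.Theorems.ImplosionDichotomyDenseExcursionPackingAnalyticOrderOne

/-!
# Calculus of the `G`-Taylor coefficients of a jointly smooth family (hierarchy of `Γ`, all orders)
# (crux `DenseExcursion`, stmt-AtomisticToContinuum-12586, line `packing-analytic-implosion`)

Helper file (`--supports stmt-AtomisticToContinuum-12586`, line lead a2, stub `stub_analyticPackingImplosion`).
The formal hierarchy of the analytic packing implosion `Γ = SS + Σ Gᵏ X_k` at EVERY order `k` reads the
`k`-th `G`-Taylor coefficients `X_k(x) = ∂_G^k (w, s)(0, x)/k!` of a jointly smooth family `(w, s)(G, x)`; two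
pieces of calculus are needed beyond the order-one file (`…PackingAnalyticOrderOne`, whose slice/Schwarz lemmas we
reuse) and are kernel-checked here:

* EXCHANGE OF `∂_G^k` WITH `∂_x` (`hasDerivAt_iteratedDerivG`, REGISTERED helper `hasDerivAt_taylorCoeffG`): for
  `Φ : ℝ → ℝ → F` jointly `C^∞` on `(−g₀, g₀) × ℝ`, every `x ↦ ∂_G^k Φ(G, x)` is differentiable with derivative
  `∂_G^k (∂_x Φ)(G, x)` (`G ∈ (−g₀, g₀)`); induction on `k` through `∂_G^{k+1} = ∂_G^k ∂_G` and Schwarz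
  (`derivX_derivG_eq`), the families `∂_G Φ`, `∂_x Φ`, `∂_G^k Φ` staying jointly `C^∞` (`contDiffOn_derivG/X`,
  `contDiffOn_iteratedDerivG`); slices `G ↦ ∂_G^k Φ(G, x)`, `G ↦ ∂_x Φ(G, x)` are `C^∞` (`contDiffAt_sliceG…`).
* TAYLOR COEFFICIENTS AT A POINT AS A POWER SERIES (`PowerSeries.mk (n ↦ f⁽ⁿ⁾(0)/n!)`): products go to products
  (`taylorSeries_mul`, Leibniz `iteratedDeriv_mul`), sums/differences/constants/scalars accordingly, `G · f(G)` to
  `X · (series of f)` (`taylorSeries_id_mul`), `f′` to the shifted series (`coeff_taylorSeries_deriv`), and germs at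
  `0` suffice (`taylorSeries_congr`). With these the two equations of `AnalyticPackingImplosion` become identities of
  real power series in `G` at each `x`, whose `k`-th coefficients are the order-`k` hierarchy (next file).

Pure calculus over Mathlib. NOT here: the hierarchy itself, `Γ`, norms.
-/

noncomputable section

open Filter Set Finset PowerSeries
open scoped Topology ContDiff Nat

namespace Summit.AtomisticToContinuum.HydrodynamicLimit.Theorems.PackingAnalyticImplosion

/-! ## Joint smoothness of `∂_G Φ`, `∂_x Φ`, `∂_G^k Φ` and the exchange `∂_x ∂_G^k = ∂_G^k ∂_x` -/

section Exchange

variable {F : Type*} [NormedAddCommGroup F] [NormedSpace ℝ F]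

/-- The parameter strip `(−g₀, g₀) × ℝ` is open. [folklore] -/
theorem isOpen_strip (g₀ : ℝ) : IsOpen (Set.Ioo (-g₀) g₀ ×ˢ (Set.univ : Set ℝ)) :=
  isOpen_Ioo.prod isOpen_univ

/-- A jointly `C^∞` family is `C^∞` at every point of the (open) strip. [folklore] -/
theorem contDiffAt_of_strip {Φ : ℝ → ℝ → F} {g₀ : ℝ}
    (hΦ : ContDiffOn ℝ ∞ (Function.uncurry Φ) (Set.Ioo (-g₀) g₀ ×ˢ Set.univ)) {G : ℝ}
    (hG : G ∈ Set.Ioo (-g₀) g₀) (x : ℝ) : ContDiffAt ℝ ∞ (Function.uncurry Φ) (G, x) :=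
  hΦ.contDiffAt ((isOpen_strip g₀).mem_nhds ⟨hG, Set.mem_univ x⟩)

/-- The `G`-slice `G ↦ Φ G x` of a jointly `C^∞` family is `C^∞` at every `G ∈ (−g₀, g₀)`. [folklore] -/
theorem contDiffAt_sliceG {Φ : ℝ → ℝ → F} {g₀ : ℝ}
    (hΦ : ContDiffOn ℝ ∞ (Function.uncurry Φ) (Set.Ioo (-g₀) g₀ ×ˢ Set.univ)) {G : ℝ}
    (hG : G ∈ Set.Ioo (-g₀) g₀) (x : ℝ) : ContDiffAt ℝ ∞ (fun G' => Φ G' x) G := by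
  have h1 : ContDiffAt ℝ ∞ (fun G' : ℝ => (G', x)) G := contDiffAt_id.prodMk contDiffAt_const
  exact (contDiffAt_of_strip hΦ hG x).comp G h1

/-- The `x`-slice `y ↦ Φ G y` of a jointly `C^∞` family is `C^∞` (`G ∈ (−g₀, g₀)`). [folklore] -/
theorem contDiffAt_sliceX {Φ : ℝ → ℝ → F} {g₀ : ℝ}
    (hΦ : ContDiffOn ℝ ∞ (Function.uncurry Φ) (Set.Ioo (-g₀) g₀ ×ˢ Set.univ)) {G : ℝ}
    (hG : G ∈ Set.Ioo (-g₀) g₀) (x : ℝ) : ContDiffAt ℝ ∞ (fun y => Φ G y) x := by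
  have h1 : ContDiffAt ℝ ∞ (fun y : ℝ => (G, y)) x := contDiffAt_const.prodMk contDiffAt_id
  exact (contDiffAt_of_strip hΦ hG x).comp x h1

/-- On the strip, the partial `G`-derivative of the curried family is `DΦ (G, x) (1, 0)`. [folklore] -/
theorem derivG_eq_fderiv {Φ : ℝ → ℝ → F} {g₀ : ℝ}
    (hΦ : ContDiffOn ℝ ∞ (Function.uncurry Φ) (Set.Ioo (-g₀) g₀ ×ˢ Set.univ)) {G : ℝ}
    (hG : G ∈ Set.Ioo (-g₀) g₀) (x : ℝ) :
    deriv (fun G' => Φ G' x) G = fderiv ℝ (Function.uncurry Φ) (G, x) (1, 0) :=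
  (hasDerivAt_slice_fst ((contDiffAt_of_strip hΦ hG x).differentiableAt (by simp))).deriv

/-- On the strip, the partial `x`-derivative of the curried family is `DΦ (G, x) (0, 1)`. [folklore] -/
theorem derivX_eq_fderiv {Φ : ℝ → ℝ → F} {g₀ : ℝ}
    (hΦ : ContDiffOn ℝ ∞ (Function.uncurry Φ) (Set.Ioo (-g₀) g₀ ×ˢ Set.univ)) {G : ℝ}
    (hG : G ∈ Set.Ioo (-g₀) g₀) (x : ℝ) :
    deriv (fun y => Φ G y) x = fderiv ℝ (Function.uncurry Φ) (G, x) (0, 1) :=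
  (hasDerivAt_slice_snd ((contDiffAt_of_strip hΦ hG x).differentiableAt (by simp))).deriv

/-- The partial `G`-derivative `∂_G Φ` of a jointly `C^∞` family is jointly `C^∞` on the strip. [folklore] -/
theorem contDiffOn_derivG {Φ : ℝ → ℝ → F} {g₀ : ℝ}
    (hΦ : ContDiffOn ℝ ∞ (Function.uncurry Φ) (Set.Ioo (-g₀) g₀ ×ˢ Set.univ)) :
    ContDiffOn ℝ ∞ (Function.uncurry fun G x => deriv (fun G' => Φ G' x) G) (Set.Ioo (-g₀) g₀ ×ˢ Set.univ) := by
  have hD := ((contDiffOn_infty_iff_fderiv_of_isOpen (isOpen_strip g₀)).1 hΦ).2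
  have hD1 : ContDiffOn ℝ ∞ (fun p : ℝ × ℝ => fderiv ℝ (Function.uncurry Φ) p (1, 0))
      (Set.Ioo (-g₀) g₀ ×ˢ Set.univ) := hD.clm_apply contDiffOn_const
  refine hD1.congr ?_
  rintro ⟨G, x⟩ ⟨hG, -⟩
  exact derivG_eq_fderiv hΦ hG x

/-- The partial `x`-derivative `∂_x Φ` of a jointly `C^∞` family is jointly `C^∞` on the strip. [folklore] -/
theorem contDiffOn_derivX {Φ : ℝ → ℝ → F} {g₀ : ℝ}
    (hΦ : ContDiffOn ℝ ∞ (Function.uncurry Φ) (Set.Ioo (-g₀) g₀ ×ˢ Set.univ)) :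
    ContDiffOn ℝ ∞ (Function.uncurry fun G x => deriv (fun y => Φ G y) x) (Set.Ioo (-g₀) g₀ ×ˢ Set.univ) := by
  have hD := ((contDiffOn_infty_iff_fderiv_of_isOpen (isOpen_strip g₀)).1 hΦ).2
  have hD1 : ContDiffOn ℝ ∞ (fun p : ℝ × ℝ => fderiv ℝ (Function.uncurry Φ) p (0, 1))
      (Set.Ioo (-g₀) g₀ ×ˢ Set.univ) := hD.clm_apply contDiffOn_const
  refine hD1.congr ?_
  rintro ⟨G, x⟩ ⟨hG, -⟩
  exact derivX_eq_fderiv hΦ hG x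

/-- SCHWARZ for the curried partials on the strip: `∂_x ∂_G Φ = ∂_G ∂_x Φ` at every `(G, x)`, `G ∈ (−g₀, g₀)`.
[folklore] -/
theorem derivX_derivG_eq {Φ : ℝ → ℝ → F} {g₀ : ℝ}
    (hΦ : ContDiffOn ℝ ∞ (Function.uncurry Φ) (Set.Ioo (-g₀) g₀ ×ˢ Set.univ)) {G : ℝ}
    (hG : G ∈ Set.Ioo (-g₀) g₀) (x : ℝ) :
    deriv (fun y => deriv (fun G' => Φ G' y) G) x = deriv (fun G' => deriv (fun y => Φ G' y) x) G := by
  have h2 : ContDiffAt ℝ 2 (Function.uncurry Φ) (G, x) :=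
    (contDiffAt_of_strip hΦ hG x).of_le (ENat.natCast_le_of_coe_top_le_withTop le_rfl 2)
  -- left side: the function `y ↦ ∂_G Φ(G, y)` is `y ↦ DΦ (G, y) (1, 0)`
  have hl : (fun y => deriv (fun G' => Φ G' y) G) = fun y => fderiv ℝ (Function.uncurry Φ) (G, y) (1, 0) :=
    funext fun y => derivG_eq_fderiv hΦ hG y
  have hL : HasDerivAt (fun y => deriv (fun G' => Φ G' y) G)
      (fderiv ℝ (fderiv ℝ (Function.uncurry Φ)) (G, x) (0, 1) (1, 0)) x := by
    rw [hl]
    exact hasDerivAt_fderiv_slice_snd h2 (1, 0)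
  -- right side: `G' ↦ ∂_x Φ(G', x)` agrees near `G` with `G' ↦ DΦ (G', x) (0, 1)`
  have hIn : Set.Ioo (-g₀) g₀ ∈ 𝓝 G := isOpen_Ioo.mem_nhds hG
  have hr : (fun G' => fderiv ℝ (Function.uncurry Φ) (G', x) (0, 1)) =ᶠ[𝓝 G]
      fun G' => deriv (fun y => Φ G' y) x := by
    filter_upwards [hIn] with G' hG' using (derivX_eq_fderiv hΦ hG' x).symm
  have hR : HasDerivAt (fun G' => deriv (fun y => Φ G' y) x)
      (fderiv ℝ (fderiv ℝ (Function.uncurry Φ)) (G, x) (1, 0) (0, 1)) G :=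
    (hasDerivAt_fderiv_slice_fst h2 (0, 1)).congr_of_eventuallyEq hr.symm
  rw [hL.deriv, hR.deriv, fderiv_fderiv_swap h2 (0, 1) (1, 0)]

/-- The iterated partial `G`-derivatives `∂_G^k Φ` of a jointly `C^∞` family are jointly `C^∞` on the strip.
[folklore] -/
theorem contDiffOn_iteratedDerivG {Φ : ℝ → ℝ → F} {g₀ : ℝ}
    (hΦ : ContDiffOn ℝ ∞ (Function.uncurry Φ) (Set.Ioo (-g₀) g₀ ×ˢ Set.univ)) (k : ℕ) :
    ContDiffOn ℝ ∞ (Function.uncurry fun G x => iteratedDeriv k (fun G' => Φ G' x) G)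
      (Set.Ioo (-g₀) g₀ ×ˢ Set.univ) := by
  induction k generalizing Φ with
  | zero => simpa only [iteratedDeriv_zero] using hΦ
  | succ k ih =>
    have e : (Function.uncurry fun G x => iteratedDeriv (k + 1) (fun G' => Φ G' x) G) =
        Function.uncurry fun G x => iteratedDeriv k (fun G' => deriv (fun G'' => Φ G'' x) G') G := by
      funext p
      simp only [Function.uncurry, iteratedDeriv_succ']
    rw [e]
    exact ih (contDiffOn_derivG hΦ)

/-- The `G`-slice `G ↦ ∂_G^k Φ(G, x)` is `C^∞` at every `G ∈ (−g₀, g₀)`. [folklore] -/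
theorem contDiffAt_iteratedDerivG {Φ : ℝ → ℝ → F} {g₀ : ℝ}
    (hΦ : ContDiffOn ℝ ∞ (Function.uncurry Φ) (Set.Ioo (-g₀) g₀ ×ˢ Set.univ)) (k : ℕ) {G : ℝ}
    (hG : G ∈ Set.Ioo (-g₀) g₀) (x : ℝ) :
    ContDiffAt ℝ ∞ (fun G' => iteratedDeriv k (fun G'' => Φ G'' x) G') G :=
  contDiffAt_sliceG (Φ := fun G x => iteratedDeriv k (fun G' => Φ G' x) G) (contDiffOn_iteratedDerivG hΦ k) hG x

/-- The `G`-slice of the `x`-derivative, `G ↦ ∂_x Φ(G, x)`, is `C^∞` at every `G ∈ (−g₀, g₀)`. [folklore] -/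
theorem contDiffAt_sliceG_derivX {Φ : ℝ → ℝ → F} {g₀ : ℝ}
    (hΦ : ContDiffOn ℝ ∞ (Function.uncurry Φ) (Set.Ioo (-g₀) g₀ ×ˢ Set.univ)) {G : ℝ}
    (hG : G ∈ Set.Ioo (-g₀) g₀) (x : ℝ) : ContDiffAt ℝ ∞ (fun G' => deriv (fun y => Φ G' y) x) G :=
  contDiffAt_sliceG (Φ := fun G x => deriv (fun y => Φ G y) x) (contDiffOn_derivX hΦ) hG x

/-- **EXCHANGE OF `∂_G^k` WITH `∂_x`.** For a jointly `C^∞` family `Φ` on `(−g₀, g₀) × ℝ` and `G ∈ (−g₀, g₀)`,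
`x ↦ ∂_G^k Φ(G, x)` has derivative `∂_G^k (∂_x Φ)(G, x)` at every `x`. [folklore] -/
theorem hasDerivAt_iteratedDerivG {Φ : ℝ → ℝ → F} {g₀ : ℝ}
    (hΦ : ContDiffOn ℝ ∞ (Function.uncurry Φ) (Set.Ioo (-g₀) g₀ ×ˢ Set.univ)) (k : ℕ) {G : ℝ}
    (hG : G ∈ Set.Ioo (-g₀) g₀) (x : ℝ) :
    HasDerivAt (fun y => iteratedDeriv k (fun G' => Φ G' y) G)
      (iteratedDeriv k (fun G' => deriv (fun y => Φ G' y) x) G) x := by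
  induction k generalizing Φ with
  | zero =>
    simp only [iteratedDeriv_zero]
    exact ((contDiffAt_sliceX hΦ hG x).differentiableAt (by simp)).hasDerivAt
  | succ k ih =>
    -- `∂_G^{k+1} Φ = ∂_G^k (∂_G Φ)` as functions of `y`
    have e1 : (fun y => iteratedDeriv (k + 1) (fun G' => Φ G' y) G) =
        fun y => iteratedDeriv k (fun G' => deriv (fun G'' => Φ G'' y) G') G := by
      funext y
      rw [iteratedDeriv_succ']
    rw [e1]
    have h := ih (Φ := fun G y => deriv (fun G'' => Φ G'' y) G) (contDiffOn_derivG hΦ)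
    -- Schwarz inside the iterated derivative: `∂_x ∂_G Φ = ∂_G ∂_x Φ` on the strip near `G`
    have hIn : Set.Ioo (-g₀) g₀ ∈ 𝓝 G := isOpen_Ioo.mem_nhds hG
    have hsw : (fun G' => deriv (fun y => deriv (fun G'' => Φ G'' y) G') x) =ᶠ[𝓝 G]
        fun G' => deriv (fun G'' => deriv (fun y => Φ G'' y) x) G' := by
      filter_upwards [hIn] with G' hG' using derivX_derivG_eq hΦ hG' x
    have e2 : iteratedDeriv k (fun G' => deriv (fun y => deriv (fun G'' => Φ G'' y) G') x) G =
        iteratedDeriv (k + 1) (fun G' => deriv (fun y => Φ G' y) x) G := by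
      rw [hsw.iteratedDeriv_eq, iteratedDeriv_succ']
    simpa only [e2] using h

/-- **The `x`-derivative of a `G`-Taylor coefficient** (registered helper `hasDerivAt_taylorCoeffG`): for a jointly
`C^∞` family `Φ` on `(−g₀, g₀) × ℝ`, the coefficient `x ↦ ∂_G^k Φ(0, x)/k!` has derivative `∂_G^k(∂_x Φ)(0, x)/k!`
at every `x`. [folklore] -/
theorem hasDerivAt_taylorCoeffG :
    ∀ (Φ : ℝ → ℝ → ℝ) (g₀ : ℝ), 0 < g₀ →
      ContDiffOn ℝ ∞ (fun p : ℝ × ℝ => Φ p.1 p.2) (Set.Ioo (-g₀) g₀ ×ˢ Set.univ) →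
      ∀ (k : ℕ) (x : ℝ), HasDerivAt (fun y => iteratedDeriv k (fun G => Φ G y) 0 / (k.factorial : ℝ))
        (iteratedDeriv k (fun G => deriv (fun y => Φ G y) x) 0 / (k.factorial : ℝ)) x := by
  intro Φ g₀ hg₀ hΦ k x
  have h0 : (0 : ℝ) ∈ Set.Ioo (-g₀) g₀ := ⟨by linarith, hg₀⟩
  exact (hasDerivAt_iteratedDerivG (Φ := Φ) hΦ k h0 x).div_const _

end Exchange

/-! ## Taylor coefficients at `0` as a real power series -/

section Taylor

/-- LEIBNIZ in Taylor-coefficient form: the coefficients `f⁽ⁿ⁾(0)/n!` of a product are the Cauchy product of the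
coefficients. [folklore] -/
theorem taylorSeries_mul {f g : ℝ → ℝ} (hf : ContDiffAt ℝ ∞ f 0) (hg : ContDiffAt ℝ ∞ g 0) :
    PowerSeries.mk (fun n => iteratedDeriv n (f * g) 0 / (n.factorial : ℝ)) =
      PowerSeries.mk (fun n => iteratedDeriv n f 0 / (n.factorial : ℝ)) *
        PowerSeries.mk (fun n => iteratedDeriv n g 0 / (n.factorial : ℝ)) := by
  ext n
  rw [coeff_mul, coeff_mk, Nat.sum_antidiagonal_eq_sum_range_succ
    (fun i j => coeff i (PowerSeries.mk fun n => iteratedDeriv n f 0 / (n.factorial : ℝ)) *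
      coeff j (PowerSeries.mk fun n => iteratedDeriv n g 0 / (n.factorial : ℝ))) n]
  simp only [coeff_mk]
  rw [iteratedDeriv_mul (hf.of_le (by exact_mod_cast le_top)) (hg.of_le (by exact_mod_cast le_top)), sum_div]
  refine sum_congr rfl fun i hi => ?_
  have hin : i ≤ n := Nat.lt_succ_iff.mp (mem_range.mp hi)
  have hchoose : ((n.choose i : ℕ) : ℝ) * (i.factorial : ℝ) * ((n - i).factorial : ℝ) = (n.factorial : ℝ) := by
    exact_mod_cast Nat.choose_mul_factorial_mul_factorial hin
  have hi0 : (i.factorial : ℝ) ≠ 0 := by positivity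
  have hni0 : ((n - i).factorial : ℝ) ≠ 0 := by positivity
  have hn0 : (n.factorial : ℝ) ≠ 0 := by positivity
  field_simp
  rw [← hchoose]
  ring

/-- Taylor coefficients of a sum. [folklore] -/
theorem taylorSeries_add {f g : ℝ → ℝ} (hf : ContDiffAt ℝ ∞ f 0) (hg : ContDiffAt ℝ ∞ g 0) :
    PowerSeries.mk (fun n => iteratedDeriv n (f + g) 0 / (n.factorial : ℝ)) =
      PowerSeries.mk (fun n => iteratedDeriv n f 0 / (n.factorial : ℝ)) +
        PowerSeries.mk (fun n => iteratedDeriv n g 0 / (n.factorial : ℝ)) := by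
  ext n
  simp only [map_add, coeff_mk]
  rw [iteratedDeriv_add (hf.of_le (by exact_mod_cast le_top)) (hg.of_le (by exact_mod_cast le_top)), add_div]

/-- Taylor coefficients of a difference. [folklore] -/
theorem taylorSeries_sub {f g : ℝ → ℝ} (hf : ContDiffAt ℝ ∞ f 0) (hg : ContDiffAt ℝ ∞ g 0) :
    PowerSeries.mk (fun n => iteratedDeriv n (f - g) 0 / (n.factorial : ℝ)) =
      PowerSeries.mk (fun n => iteratedDeriv n f 0 / (n.factorial : ℝ)) -
        PowerSeries.mk (fun n => iteratedDeriv n g 0 / (n.factorial : ℝ)) := by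
  ext n
  simp only [map_sub, coeff_mk]
  rw [iteratedDeriv_sub (hf.of_le (by exact_mod_cast le_top)) (hg.of_le (by exact_mod_cast le_top)), sub_div]

/-- Taylor coefficients of a constant: the constant series. [folklore] -/
theorem taylorSeries_const (c : ℝ) :
    PowerSeries.mk (fun n => iteratedDeriv n (fun _ : ℝ => c) 0 / (n.factorial : ℝ)) = PowerSeries.C c := by
  ext n
  simp only [coeff_mk, iteratedDeriv_const, coeff_C]
  split_ifs with h
  · subst h; simp
  · simp

/-- Taylor coefficients of a scalar multiple. [folklore] -/
theorem taylorSeries_const_mul {f : ℝ → ℝ} (hf : ContDiffAt ℝ ∞ f 0) (c : ℝ) :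
    PowerSeries.mk (fun n => iteratedDeriv n (fun G => c * f G) 0 / (n.factorial : ℝ)) =
      PowerSeries.C c * PowerSeries.mk (fun n => iteratedDeriv n f 0 / (n.factorial : ℝ)) := by
  ext n
  simp only [coeff_mk, coeff_C_mul]
  rw [iteratedDeriv_const_mul c (hf.of_le (by exact_mod_cast le_top)), mul_div_assoc]

/-- `∂ⁿ(G ↦ G·f(G))(0) = n · f⁽ⁿ⁻¹⁾(0)`. [folklore] -/
theorem iteratedDeriv_id_mul_zero {f : ℝ → ℝ} {n : ℕ} (hf : ContDiffAt ℝ (n + 1 : ℕ) f 0) :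
    iteratedDeriv (n + 1) (fun G => G * f G) 0 = (n + 1 : ℕ) * iteratedDeriv n f 0 := by
  have hid : ContDiffAt ℝ (n + 1 : ℕ) (fun G : ℝ => G) 0 := contDiffAt_id
  have h := iteratedDeriv_mul (f := fun G : ℝ => G) (g := f) hid hf
  have e : ((fun G : ℝ => G) * f) = fun G => G * f G := rfl
  rw [e] at h
  rw [h, sum_eq_single 1]
  · simp [iteratedDeriv_fun_id_zero]
  · intro i _ hi
    simp [iteratedDeriv_fun_id_zero, hi]
  · intro h1
    exfalso
    exact h1 (mem_range.mpr (by omega))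

/-- Taylor coefficients of `G ↦ G · f(G)`: the series of `f` shifted by `X`. [folklore] -/
theorem taylorSeries_id_mul {f : ℝ → ℝ} (hf : ContDiffAt ℝ ∞ f 0) :
    PowerSeries.mk (fun n => iteratedDeriv n (fun G => G * f G) 0 / (n.factorial : ℝ)) =
      PowerSeries.X * PowerSeries.mk (fun n => iteratedDeriv n f 0 / (n.factorial : ℝ)) := by
  ext n
  rcases n with _ | n
  · simp
  · rw [coeff_succ_X_mul, coeff_mk, coeff_mk, iteratedDeriv_id_mul_zero (hf.of_le (by exact_mod_cast le_top)),
      Nat.factorial_succ]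
    push_cast
    have hn : (n.factorial : ℝ) ≠ 0 := by positivity
    have hn1 : ((n : ℝ) + 1) ≠ 0 := by positivity
    field_simp

/-- Taylor coefficients of the derivative: `coeff n (series of f′) = (n + 1) · coeff (n+1) (series of f)`.
[folklore] -/
theorem coeff_taylorSeries_deriv (f : ℝ → ℝ) (n : ℕ) :
    iteratedDeriv n (deriv f) 0 / (n.factorial : ℝ) = (n + 1 : ℕ) * (iteratedDeriv (n + 1) f 0 / ((n + 1).factorial : ℝ)) := by
  rw [iteratedDeriv_succ', Nat.factorial_succ]
  push_cast
  have hn : (n.factorial : ℝ) ≠ 0 := by positivity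
  have hn1 : ((n : ℝ) + 1) ≠ 0 := by positivity
  field_simp

/-- Germs suffice: functions agreeing near `0` have the same Taylor coefficients at `0`. [folklore] -/
theorem taylorSeries_congr {f g : ℝ → ℝ} (h : f =ᶠ[𝓝 0] g) :
    PowerSeries.mk (fun n => iteratedDeriv n f 0 / (n.factorial : ℝ)) =
      PowerSeries.mk (fun n => iteratedDeriv n g 0 / (n.factorial : ℝ)) := by
  ext n
  simp only [coeff_mk, h.iteratedDeriv_eq n]

/-- The left-hand sides of the hierarchy: the `k`-th Taylor coefficient of `G ↦ c · G · f′(G)` is `c · k · (k-th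
coefficient of f)`. [folklore] -/
theorem coeff_taylorSeries_transport {f : ℝ → ℝ} (hf : ContDiffAt ℝ ∞ f 0) (c : ℝ) (k : ℕ) :
    iteratedDeriv k (fun G => c * G * deriv f G) 0 / (k.factorial : ℝ) =
      c * k * (iteratedDeriv k f 0 / (k.factorial : ℝ)) := by
  have hf' : ContDiffAt ℝ ∞ (deriv f) 0 := by
    have h : ContDiffAt ℝ ∞ (fun x => fderiv ℝ f x (1 : ℝ)) 0 :=
      (hf.fderiv_right (m := ∞) (by simp)).clm_apply contDiffAt_const
    exact h
  have e : (fun G => c * G * deriv f G) = fun G => c * (G * deriv f G) := by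
    funext G; ring
  have hseries := taylorSeries_const_mul (f := fun G => G * deriv f G) (contDiffAt_id.mul hf') c
  rw [taylorSeries_id_mul hf'] at hseries
  have hk := congrArg (coeff k) hseries
  rw [coeff_mk] at hk
  rw [e, hk]
  rcases k with _ | k
  · simp
  · rw [← mul_assoc, mul_comm (C c) X, mul_assoc, coeff_succ_X_mul, coeff_C_mul, coeff_mk,
      coeff_taylorSeries_deriv]
    push_cast
    ring

end Taylor

end Summit.AtomisticToContinuum.HydrodynamicLimit.Theorems.PackingAnalyticImplosion

end
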